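import Summits.QuantumFields.YangMills.Theorems.BalabanUVNodesSpineCarriersOfRecord13CoPH
import Literature.MathematicalPhysics.QuantumFieldTheory.Balaban1983to89.Node00.Record13CoPHChi

/-!
# THE SPINE READING TYPE AND THE SPINE-CARRIER PREDICATE OF RECORD, χ-GENERIC («Cmap» EDITION) — `SpineReading₁₃CoPHCmap N Χ`, `SRec₁₃CoPHCmap Χ cr`, the RE-CENTRED instances
# `SpineReading₁₃CoPHAx ∕ SRec₁₃CoPHAx`, and the receipt at the record's own β-slot `Χ := chiβOfRecord₁₃` (T2-core of op 5c (a), HANDS-4)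

Cell `pub-ymgap`, YM-PLAN Track A (HUMAN RULING D-0062); seat `pub-ymgap-dag-n20-d` (g45), op 5c (a) supply for K3ᴬ `SpineGivenEndpointR13SepCoPHVAx` (stmt-QuantumFields-27247; plan g99
σ4∕σ5, dag-lead g40 HANDS-4 ∕ WORDS 593; T2 by the n20 lineage's offer I.≈21880, first refusal dag-n15-c).  `--kind definition --supports stmt-QuantumFields-27247 --as helper`; COUNT-NEUTRAL.
Parent: dag-n27-c's `…SpineCarriersOfRecord13CoPH` (p-lineage of (T-SPINE)₁₃ module 4; ns `YMDAG.UVSplit`) — its §0 re-issued with the proviso binder read at a FAMILY-LEVEL β-SLOT READING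
`Χ : (F : T4Family) → Stage13Params F N → ChiSlot F N` ([Ax-3b] `Node00/Record13Chi`, [Ax-3c] `Node00/Record13CoPHChi`: `θ.Provisos₁₃CoPHChi F N χ`, `datumOfRecord₁₃CoPHChi θ χ hP`); the parent is
the instance `Χ := fun F ϑ => chiβOfRecord₁₃ F N ϑ` up to the field-wise proviso receipt `provisos₁₃CoPHChi_chiβ_iff` (§2), the RE-CENTRED world is `Χ := fun F ϑ => chiβOfRecord₁₃Ax F N ϑ` (§3).
NOTHING of record is edited; the parent's K5-stub instances (§2–§4 there) are NOT re-issued here (not read by K3ᴬ v8; an append if wanted).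

HONEST FRAMING.  A TYPE, a pins-only predicate and `rfl`-grade faces; nothing of Bałaban's asserted, ported or discharged; no `Provisos₁₃CoPHChi` inhabitant claimed; K-Ax cruxes OPEN;
counts UNMOVED (typed 28∕28 · discharged 8∕27); one finite four-torus programme at fixed `ε` — NOT ℝ⁴, NOT OS, NOT a mass gap, NOT the Clay problem.  No `instance`, no `notation`, no `sorry`.
-/

open Finset

namespace YMDAG.UVSplit

open Literature.MathematicalPhysics.QuantumFieldTheory.Balaban1983to89
open Literature.MathematicalPhysics.QuantumFieldTheory.Balaban1983to89.T4Continuum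
open Summit.QuantumFields.BalabanUV.T4Continuum.Spine
open Node00 (Stage13Params Stage13HParams ChiSlot chiβOfRecord₁₃ chiβOfRecord₁₃Ax datumOfRecord₁₃CoPH datumOfRecord₁₃CoPHChi provisos₁₃CoPHChi_chiβ_iff)

/-! ## §0 The χ-generic reading type and the pins-only predicate -/

/-- **A READING OF SPINE CARRIERS OFF NODE 00's STAGE-13 TUPLES, THE PROVISOS READ AT THE β-SLOT `Χ F θ`**: for every family, every Stage-13 tuple `θ` WITH its χ-generic CoPH
provisos at `χ := Χ F θ.toStage13Params`, every bare sequence and loop string, ONE term-class carrier bundle.  The TYPE only. [bookkeeping] -/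
abbrev SpineReading₁₃CoPHCmap (N : ℕ) [NeZero N] (Χ : (F : T4Family) → Stage13Params F N → ChiSlot F N) : Type 1 :=
  (F : T4Family) → (θ : Stage13HParams F N) → θ.Provisos₁₃CoPHChi F N (Χ F θ.toStage13Params) → (ℕ → ℝ) → List (ULoop F) → SpineCarriers

variable {N : ℕ} [NeZero N]

/-- **THE SPINE-CARRIER PREDICATE OF RECORD AT THE β-SLOT READING `Χ`, KEYED BY `cr`** (PINS ONLY): at `(F, D, g₀, os)` it pins exactly the bundles `cr F θ hP g₀ os` of the ADMISSIBLE
Stage-13 tuples `θ` WITH χ-PROVISOS `hP` whose χ-generic CoPH datum IS `D`. [bookkeeping] -/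
def SRec₁₃CoPHCmap (Χ : (F : T4Family) → Stage13Params F N → ChiSlot F N) (cr : SpineReading₁₃CoPHCmap N Χ) : SpineRecordPred N :=
  fun F D g₀ os S => ∃ (θ : Stage13HParams F N) (hP : θ.Provisos₁₃CoPHChi F N (Χ F θ.toStage13Params)),
    θ.Admissible F N ∧ D = datumOfRecord₁₃CoPHChi F N θ (Χ F θ.toStage13Params) hP ∧ S = cr F θ hP g₀ os

/-! ## §1 Faces -/

section Faces

variable (Χ : (F : T4Family) → Stage13Params F N → ChiSlot F N) (cr : SpineReading₁₃CoPHCmap N Χ)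

/-- Unfolding (`Iff.rfl`). [bookkeeping] -/
theorem sRec₁₃CoPHCmap_iff {F : T4Family} (D : Datum F N) (g₀ : ℕ → ℝ) (os : List (ULoop F)) (S : SpineCarriers) :
    SRec₁₃CoPHCmap Χ cr F D g₀ os S ↔ ∃ (θ : Stage13HParams F N) (hP : θ.Provisos₁₃CoPHChi F N (Χ F θ.toStage13Params)),
      θ.Admissible F N ∧ D = datumOfRecord₁₃CoPHChi F N θ (Χ F θ.toStage13Params) hP ∧ S = cr F θ hP g₀ os :=
  Iff.rfl

/-- **THE READING's BUNDLE IS PINNED AT ITS OWN χ-DATUM.** [bookkeeping] -/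
theorem sRec₁₃CoPHCmap_self {F : T4Family} (θ : Stage13HParams F N) (hP : θ.Provisos₁₃CoPHChi F N (Χ F θ.toStage13Params)) (hθ : θ.Admissible F N)
    (g₀ : ℕ → ℝ) (os : List (ULoop F)) :
    SRec₁₃CoPHCmap Χ cr F (datumOfRecord₁₃CoPHChi F N θ (Χ F θ.toStage13Params) hP) g₀ os (cr F θ hP g₀ os) :=
  ⟨θ, hP, hθ, rfl, rfl⟩

/-- Every pinned bundle comes with an admissible Stage-13 tuple with χ-provisos realising the datum, of which it is the reading. [bookkeeping] -/
theorem exists_stage13_of_sRec₁₃CoPHCmap {F : T4Family} {D : Datum F N} {g₀ : ℕ → ℝ} {os : List (ULoop F)} {S : SpineCarriers}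
    (h : SRec₁₃CoPHCmap Χ cr F D g₀ os S) :
    ∃ (θ : Stage13HParams F N) (hP : θ.Provisos₁₃CoPHChi F N (Χ F θ.toStage13Params)),
      θ.Admissible F N ∧ D = datumOfRecord₁₃CoPHChi F N θ (Χ F θ.toStage13Params) hP ∧ S = cr F θ hP g₀ os :=
  h

/-- Readings that agree at every χ-keyed tuple pin the same bundles. [bookkeeping] -/
theorem sRec₁₃CoPHCmap_congr {cr cr' : SpineReading₁₃CoPHCmap N Χ} (h : ∀ F θ hP g₀ os, cr F θ hP g₀ os = cr' F θ hP g₀ os) :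
    SRec₁₃CoPHCmap Χ cr = SRec₁₃CoPHCmap Χ cr' := by
  funext F D g₀ os S
  apply propext
  constructor
  · rintro ⟨θ, hP, hθ, hD, hS⟩; exact ⟨θ, hP, hθ, hD, hS.trans (h F θ hP g₀ os)⟩
  · rintro ⟨θ, hP, hθ, hD, hS⟩; exact ⟨θ, hP, hθ, hD, hS.trans (h F θ hP g₀ os).symm⟩

end Faces

/-! ## §2 Receipt at the record's own β-slot `Χ := chiβOfRecord₁₃`: the parent's readings and pins, through the proviso receipt -/

section Receipt

/-- A parent reading READ AT THE χ-KEYED TUPLES of the record's own β-slot (provisos transported by `provisos₁₃CoPHChi_chiβ_iff`). [bookkeeping] -/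
def SpineReading₁₃CoPH.toCmap (cr : SpineReading₁₃CoPH N) : SpineReading₁₃CoPHCmap N (fun F => chiβOfRecord₁₃ F N) :=
  fun F θ hP g₀ os => cr F θ ((provisos₁₃CoPHChi_chiβ_iff θ).1 hP) g₀ os

/-- A χ-reading at the record's own β-slot READ AT THE PARENT's TUPLES. [bookkeeping] -/
def SpineReading₁₃CoPHCmap.ofChiβ (cr : SpineReading₁₃CoPHCmap N (fun F => chiβOfRecord₁₃ F N)) : SpineReading₁₃CoPH N :=
  fun F θ hP g₀ os => cr F θ ((provisos₁₃CoPHChi_chiβ_iff θ).2 hP) g₀ os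

/-- Round trip (proof irrelevance). [bookkeeping] -/
theorem SpineReading₁₃CoPH.ofChiβ_toCmap (cr : SpineReading₁₃CoPH N) : SpineReading₁₃CoPHCmap.ofChiβ cr.toCmap = cr := rfl

/-- Round trip (proof irrelevance). [bookkeeping] -/
theorem SpineReading₁₃CoPHCmap.toCmap_ofChiβ (cr : SpineReading₁₃CoPHCmap N (fun F => chiβOfRecord₁₃ F N)) : (SpineReading₁₃CoPHCmap.ofChiβ cr).toCmap = cr := rfl

/-- **RECEIPT**: at the record's own β-slot the χ-predicate of a transported parent reading IS the parent's predicate (the χ-datum at `chiβOfRecord₁₃ θ` is the CoPH datum,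
`datumOfRecord₁₃CoPHChi_chiβ`). [bookkeeping] -/
theorem sRec₁₃CoPHCmap_chiβ (cr : SpineReading₁₃CoPH N) : SRec₁₃CoPHCmap (fun F => chiβOfRecord₁₃ F N) cr.toCmap = SRec₁₃CoPH cr := by
  funext F D g₀ os S
  apply propext
  constructor
  · rintro ⟨θ, hP, hθ, hD, hS⟩
    exact ⟨θ, (provisos₁₃CoPHChi_chiβ_iff θ).1 hP, hθ, hD, hS⟩
  · rintro ⟨θ, hP, hθ, hD, hS⟩
    exact ⟨θ, (provisos₁₃CoPHChi_chiβ_iff θ).2 hP, hθ, hD, hS⟩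

end Receipt

/-! ## §3 The RE-CENTRED instances (`Χ := chiβOfRecord₁₃Ax`) -/

/-- **THE READING TYPE, RE-CENTRED** — K3ᴬ v8's `SpineReading`. [bookkeeping] -/
abbrev SpineReading₁₃CoPHAx (N : ℕ) [NeZero N] : Type 1 := SpineReading₁₃CoPHCmap N (fun F => chiβOfRecord₁₃Ax F N)

/-- **THE SPINE-CARRIER PREDICATE, RE-CENTRED.** [bookkeeping] -/
abbrev SRec₁₃CoPHAx (cr : SpineReading₁₃CoPHAx N) : SpineRecordPred N := SRec₁₃CoPHCmap (fun F => chiβOfRecord₁₃Ax F N) cr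

end YMDAG.UVSplit
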